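import Summits.CriticalPhenomena.CardyFormulaZ2.Theorems.CardyBoundaryCoulombGasBoundaryDefectGaussianRStubRealisabilityPart35

/-!
# Stub `stub_dictionaryPositivity` of line `rainbow-monomials-in-excursion-kernels` — Part 36:
# tracked cuts are strand ends (II): every ghost is mentioned by the walk; the tracked corners at
# the ghost of a rail dart
# (crux `BoundaryDefectGaussianR`, stmt-CriticalPhenomena-14132; insertion dictionary D2, layer 3b)

Second of four files on hypothesis (E1) of the rainbow forcing (Part 18). Notation of Parts 7, 8,
20–27, 31–35: `ι` admissible on `V`, `ds = cycle V d₀`, `P = ds.length`, `st t` the walk state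
after `t` darts, FLAT insertion points (radius `L + 3`), local CHARTS at the boundary vertices.

* `tc_spoke_on_wired` — for an arc vertex `v` and `v + dir k' ∉ V`, the exterior dart `(v, k')`
  lies on the cycle, on a wired stretch (the chain-lemma argument of `vertH_spoke`, Part 34);
* `tc_ghost_mention` — **every ghost is mentioned by some entry of the collar walk** (a lattice
  neighbour of an arc vertex is the tip of a wired dart; a pocket corner is mentioned by the
  pocket's dart), hence is TOUCHED by a dart of the cycle lying on a wired stretch;
* at a RAIL dart `ds[t] = (c, K)` (radius-`2` frame charts at `c` and at `c - dir (K+1)`, previous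
  dart `(c - dir (K+1), K)`; NOT necessarily active) with ghost `g = c + dir K`:
  `tc_railGhost_wired` — if `g` is a ghost, dart `t` lies on a wired stretch (before or after);
  `tc_railGhost_end` — **a tracked corner at `g` whose target edge is closed in `cfgOf ∅` is a
  registered strand end**: the corners `(g, K)`, `(g, K + 3)` are untracked (outer faces), the
  corner `(g, K + 1)` targets the spoke `{g, c}` (open), and the corner `(g, K + 2)` targets the
  far edge of the face before the dart, which is a pocket edge (open) if the stretch before is
  wired, and otherwise — free before, hence wired after — the END of the junction OPENING the arc
  at `ds[t]`, registered in `strandEnds` with tag `min ℓ ℓ'`.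

Registered one-line form: `s14_trackedCuts_railGhost`. All [folklore].
-/

namespace Summit.CriticalPhenomena.CardyFormulaZ2.Cruxes.BoundaryDefectGaussianR.RainbowMonomialsInExcursionKernels

open Literature.Probability.LatticeModels Literature.Probability.LatticeModels.CollarLegModel

section Admissible

variable (ι : LegInsertionData) (V : Finset (ℤ × ℤ)) {d₀ : Dart} (hadm : ι.IsAdmissible V)
  (h : outDart V ι.sink = some d₀) {st : ℕ → WalkState}
  (hst : ∀ t, st t = List.foldl (fun s d => s.step (ι.startAt V d)) ι.init ((cycle V d₀).take t))

include hst in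
/-- A dart where the wiredness changes is active (its level changes too). [folklore] -/
theorem tc_level_ne_of_wired_ne {t : ℕ} (ht : t < (cycle V d₀).length)
    (hw : (st (t + 1)).wired ≠ (st t).wired) : (st (t + 1)).level ≠ (st t).level := by
  rcases st_step_cases ι V hst ht with ⟨-, hw'⟩ | ⟨hsgn, hc⟩
  · exact absurd hw' hw
  · rcases hc with ⟨hl, -⟩ | ⟨hl, -, -⟩ <;> rcases hsgn with hs | hs <;> rw [hl, hs] <;> omega

include hadm h hst in
/-- **The exterior darts at an arc vertex lie on its wired stretch.** For an arc vertex `v` and a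
direction `k'` with `v + dir k' ∉ V`, the exterior dart `(v, k')` is a dart of the cycle preceded
or followed by a wired state (chain lemma at `v`: it is the wired dart through `v`, or next to it
on the cycle with no junction in between, a junction dart being a straight rail dart). [folklore] -/
theorem tc_spoke_on_wired
    (hflat : ∀ x ∈ insert ι.sink ι.source, ∃ dvec : ℤ × ℤ,
      (dvec = (1, 0) ∨ dvec = (-1, 0) ∨ dvec = (0, 1) ∨ dvec = (0, -1)) ∧
      ∀ v : ℤ × ℤ, (v.1 - x.1) ^ 2 + (v.2 - x.2) ^ 2 ≤ ((ι.sinkLegs : ℤ) + 3) ^ 2 →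
        (v ∈ V ↔ 0 ≤ (v.1 - x.1) * dvec.1 + (v.2 - x.2) * dvec.2))
    (hchart : ∀ u ∈ V, ∀ k : Fin 4, u + dir k ∉ V → ∃ (K : Fin 4) (c₁ c₂ : ℤ),
      (∀ v : ℤ × ℤ, |v.1 - u.1| ≤ 3 → |v.2 - u.2| ≤ 3 →
        (v ∈ V ↔ c₂ ≤ v.1 * (dir (K + 1)).1 + v.2 * (dir (K + 1)).2)) ∨
      (∀ v : ℤ × ℤ, |v.1 - u.1| ≤ 3 → |v.2 - u.2| ≤ 3 →
        (v ∈ V ↔ c₁ ≤ v.1 * (dir K).1 + v.2 * (dir K).2 ∧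
          c₂ ≤ v.1 * (dir (K + 1)).1 + v.2 * (dir (K + 1)).2)) ∨
      (∀ v : ℤ × ℤ, |v.1 - u.1| ≤ 3 → |v.2 - u.2| ≤ 3 →
        (v ∈ V ↔ c₂ ≤ v.1 * (dir (K + 1)).1 + v.2 * (dir (K + 1)).2 ∨
          v.1 * (dir K).1 + v.2 * (dir K).2 ≤ c₁)))
    {v : ℤ × ℤ} (hv : v ∈ (ι.collar V).arc) {k' : Fin 4} (hg' : v + dir k' ∉ V) :
    ∃ (t₂ : ℕ) (ht₂ : t₂ < (cycle V d₀).length), (cycle V d₀)[t₂] = (v, k') ∧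
      ((st t₂).wired = true ∨ (st (t₂ + 1)).wired = true) := by
  have hP := length_cycle_pos ι V hadm h
  obtain ⟨t, ht, hwadj, htv⟩ := (mem_collar_arc_iff ι V h hst).1 hv
  obtain ⟨hu, hgt⟩ := cycle_getElem_exterior ι V hadm h ht
  rcases hdk : (cycle V d₀)[t] with ⟨u, k⟩
  rw [hdk] at hu hgt htv
  simp only at hu hgt htv
  subst htv
  have hx₁ : u ∈ SixVertex.faceCorners (gapFace (u, k)) := (mem_faceCorners_gapFace _ _ _).2 (Or.inl rfl)
  have hx₂ : u ∈ SixVertex.faceCorners (gapFace (u, k')) :=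
    (mem_faceCorners_gapFace _ _ _).2 (Or.inl rfl)
  have hch := chart_of_bdry_chart hchart (e := (u, k)) hu hgt hx₁
  obtain ⟨hn1, hn2, hn3, -⟩ := add_dir_ne_self u k
  rcases touch_chain hch (e₁ := (u, k)) (e₂ := (u, k')) hu hgt hu hg' hx₁ hx₂ with
    he | he | he | ⟨e₃, hu₃, hg₃, -, he⟩
  · exact ⟨t, ht, by rw [hdk, he], hwadj⟩
  · -- `(u, k')` is the next dart
    refine ⟨(t + 1) % (cycle V d₀).length, Nat.mod_lt _ hP,
      by rw [getElem_succ_mod ι V hadm h ht, hdk, he], ?_⟩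
    obtain ⟨-, hsw⟩ := st_mod_succ ι V hadm h hst ht
    rw [hsw]
    by_cases hw1 : (st (t + 1)).wired = true
    · exact Or.inl hw1
    · exfalso
      have hw0 : (st t).wired = true := hwadj.resolve_right hw1
      have hact : ¬ ((st (t + 1)).level = (st t).level ∧ (st (t + 1)).wired = (st t).wired) :=
        fun hs => hw1 (hs.2.trans hw0)
      obtain ⟨y, k₀, hy0, hy1, -⟩ := straight_of_active ι V hadm h hst hflat ht hact
      rw [hdk] at hy0
      obtain ⟨rfl, rfl⟩ := Prod.mk.inj hy0
      rw [getElem_succ_mod ι V hadm h ht, hdk, ← he] at hy1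
      exact hn1 (Prod.mk.inj hy1).1.symm
  · -- `(u, k')` is the previous dart
    have hpred := getElem_pred_mod ι V hadm h ht (e := (u, k')) hu (by simpa [dartTip] using hg')
      (by rw [hdk]; exact he.symm)
    refine ⟨(t + (cycle V d₀).length - 1) % (cycle V d₀).length, Nat.mod_lt _ hP, hpred, ?_⟩
    obtain ⟨-, hsw⟩ := st_mod_succ ι V hadm h hst (Nat.mod_lt (t + (cycle V d₀).length - 1) hP)
    simp only [succ_pred_mod ht] at hsw
    rw [← hsw]
    by_cases hw0 : (st t).wired = true
    · exact Or.inr hw0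
    · exfalso
      have hw1 : (st (t + 1)).wired = true := hwadj.resolve_left hw0
      have hact : ¬ ((st (t + 1)).level = (st t).level ∧ (st (t + 1)).wired = (st t).wired) :=
        fun hs => hw0 (hs.2.symm.trans hw1)
      obtain ⟨y, k₀, hy0, -, -, hy3, -⟩ := straight_of_active ι V hadm h hst hflat ht hact
      rw [hdk] at hy0
      obtain ⟨rfl, rfl⟩ := Prod.mk.inj hy0
      rw [hpred] at hy3
      exact hn2 (Prod.mk.inj hy3).1.symm
  · rcases he with ⟨h31, h32⟩ | ⟨h31, h32⟩
    · -- `(u, k')` two darts ahead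
      have hlt' : (t + 1) % (cycle V d₀).length < (cycle V d₀).length := Nat.mod_lt _ hP
      have hd2 : (cycle V d₀)[((t + 1) % (cycle V d₀).length + 1) % (cycle V d₀).length]'
          (Nat.mod_lt _ hP) = (u, k') := by
        rw [getElem_succ_mod ι V hadm h hlt', getElem_succ_mod ι V hadm h ht, hdk, ← h31, ← h32]
      refine ⟨_, Nat.mod_lt _ hP, hd2, ?_⟩
      rcases wired_three ι V hadm h hst hflat ht with ⟨z, k₀, hz0, hz2⟩ | ⟨h1w, h2w, -⟩
      · exfalso
        rw [hdk] at hz0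
        obtain ⟨rfl, rfl⟩ := Prod.mk.inj hz0
        rw [hd2] at hz2
        exact hn3 (Prod.mk.inj hz2).1.symm
      · left
        rw [h2w]
        rcases hwadj with hw0 | hw1
        · exact hw0
        · rw [← h1w]; exact hw1
    · -- `(u, k')` two darts behind
      have hs₁ := getElem_pred_mod ι V hadm h ht (e := e₃) hu₃ (by simpa [dartTip] using hg₃)
        (by rw [hdk]; exact h32.symm)
      have hlt₁ : (t + (cycle V d₀).length - 1) % (cycle V d₀).length < (cycle V d₀).length :=
        Nat.mod_lt _ hP
      have hs₂ := getElem_pred_mod ι V hadm h hlt₁ (e := (u, k')) hu (by simpa [dartTip] using hg')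
        (by rw [hs₁]; exact h31.symm)
      have hlt₂ : ((t + (cycle V d₀).length - 1) % (cycle V d₀).length + (cycle V d₀).length - 1) %
          (cycle V d₀).length < (cycle V d₀).length := Nat.mod_lt _ hP
      refine ⟨_, hlt₂, hs₂, ?_⟩
      have e1 := succ_pred_mod hlt₁
      have e2 := succ_pred_mod ht
      rcases wired_three ι V hadm h hst hflat hlt₂ with ⟨z, k₀, hz0, hz2⟩ | ⟨-, h2w, h3w⟩
      · exfalso
        rw [hs₂] at hz0
        obtain ⟨rfl, rfl⟩ := Prod.mk.inj hz0
        simp only [e1] at hz2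
        simp only [e2] at hz2
        rw [hdk] at hz2
        exact (add_dir_ne_self u k').2.2.1 (Prod.mk.inj hz2).1.symm
      · simp only [e1] at h2w h3w
        simp only [e2] at h2w h3w
        left
        rcases hwadj with hw0 | hw1
        · rw [← h2w]; exact hw0
        · rw [← h3w]; exact hw1

include hadm h hst in
/-- **Every ghost is mentioned by the walk**: a ghost `g` of the jump collar is mentioned
(`LegInsertionData.mention`) by some entry of the collar walk — in particular it is a corner of
the gap face of a dart of the cycle lying on a wired stretch. [folklore] -/
theorem tc_ghost_mention
    (hflat : ∀ x ∈ insert ι.sink ι.source, ∃ dvec : ℤ × ℤ,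
      (dvec = (1, 0) ∨ dvec = (-1, 0) ∨ dvec = (0, 1) ∨ dvec = (0, -1)) ∧
      ∀ v : ℤ × ℤ, (v.1 - x.1) ^ 2 + (v.2 - x.2) ^ 2 ≤ ((ι.sinkLegs : ℤ) + 3) ^ 2 →
        (v ∈ V ↔ 0 ≤ (v.1 - x.1) * dvec.1 + (v.2 - x.2) * dvec.2))
    (hchart : ∀ u ∈ V, ∀ k : Fin 4, u + dir k ∉ V → ∃ (K : Fin 4) (c₁ c₂ : ℤ),
      (∀ v : ℤ × ℤ, |v.1 - u.1| ≤ 3 → |v.2 - u.2| ≤ 3 →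
        (v ∈ V ↔ c₂ ≤ v.1 * (dir (K + 1)).1 + v.2 * (dir (K + 1)).2)) ∨
      (∀ v : ℤ × ℤ, |v.1 - u.1| ≤ 3 → |v.2 - u.2| ≤ 3 →
        (v ∈ V ↔ c₁ ≤ v.1 * (dir K).1 + v.2 * (dir K).2 ∧
          c₂ ≤ v.1 * (dir (K + 1)).1 + v.2 * (dir (K + 1)).2)) ∨
      (∀ v : ℤ × ℤ, |v.1 - u.1| ≤ 3 → |v.2 - u.2| ≤ 3 →
        (v ∈ V ↔ c₂ ≤ v.1 * (dir (K + 1)).1 + v.2 * (dir (K + 1)).2 ∨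
          v.1 * (dir K).1 + v.2 * (dir K).2 ≤ c₁)))
    {g : ℤ × ℤ} (hg : g ∈ (ι.model V).ghosts) :
    ∃ (t : ℕ) (ht : t < (cycle V d₀).length),
      LegInsertionData.mention V g ((cycle V d₀)[t], st t, st (t + 1)) ≠ none := by
  rw [ghosts, Finset.mem_sdiff, Finset.mem_union, Finset.mem_biUnion, Finset.mem_biUnion] at hg
  obtain ⟨hcase, hgV⟩ := hg
  rcases hcase with ⟨a, ha, hga⟩ | ⟨p, hp, hgp⟩
  · obtain ⟨k', rfl⟩ := tc_mem_neighbours hga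
    obtain ⟨t₂, ht₂, hd, hw⟩ := tc_spoke_on_wired ι V hadm h hst hflat hchart (Finset.mem_inter.1 ha).1 hgV
    refine ⟨t₂, ht₂, ?_⟩
    rw [mention_of_vertex V (e := ((cycle V d₀)[t₂], st t₂, st (t₂ + 1))) hw (Or.inr (by rw [hd]; rfl))]
    simp
  · obtain ⟨t, ht, hw, hgap⟩ := (mem_collar_pocket_iff ι V h hst).1 (Finset.mem_inter.1 hp).1
    refine ⟨t, ht, ?_⟩
    rw [Ne, mention_eq_none_iff]
    exact fun hh => hh.2 ⟨hw, hgap ▸ hgp, hgV⟩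

end Admissible

section Rail

variable (ι : LegInsertionData) (V : Finset (ℤ × ℤ)) {d₀ : Dart} (hadm : ι.IsAdmissible V)
  (h : outDart V ι.sink = some d₀) {st : ℕ → WalkState}
  (hst : ∀ t, st t = List.foldl (fun s d => s.step (ι.startAt V d)) ι.init ((cycle V d₀).take t))
  {t : ℕ} (ht : t < (cycle V d₀).length) {c : ℤ × ℤ} {K : Fin 4}
  (hch : ∀ s t : ℤ, -2 ≤ s → s ≤ 2 → -2 ≤ t → t ≤ 2 → (c + s • dir (K + 1) + t • dir K ∈ V ↔ t ≤ 0))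
  (hchp : ∀ s t : ℤ, -2 ≤ s → s ≤ 2 → -2 ≤ t → t ≤ 2 →
    (c - dir (K + 1) + s • dir (K + 1) + t • dir K ∈ V ↔ t ≤ 0))
  (hds : (cycle V d₀)[t] = (c, K))
  (hpred1 : ∀ (h1 : 1 ≤ t), (cycle V d₀)[t - 1] = (c - dir (K + 1), K))
  (hpred0 : t = 0 → (cycle V d₀)[(cycle V d₀).length - 1]'(by omega) = (c - dir (K + 1), K))

include hadm h hst ht hch hds hpred1 hpred0 in
/-- **If the ghost of a rail dart is a ghost, the dart lies on a wired stretch** (before or after):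
the ghost is mentioned by some entry (`tc_ghost_mention`), whose dart touches it, hence is the rail
dart itself or the previous one mentioning it as a pocket corner. [folklore] -/
theorem tc_railGhost_wired
    (hflat : ∀ x ∈ insert ι.sink ι.source, ∃ dvec : ℤ × ℤ,
      (dvec = (1, 0) ∨ dvec = (-1, 0) ∨ dvec = (0, 1) ∨ dvec = (0, -1)) ∧
      ∀ v : ℤ × ℤ, (v.1 - x.1) ^ 2 + (v.2 - x.2) ^ 2 ≤ ((ι.sinkLegs : ℤ) + 3) ^ 2 →
        (v ∈ V ↔ 0 ≤ (v.1 - x.1) * dvec.1 + (v.2 - x.2) * dvec.2))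
    (hchart : ∀ u ∈ V, ∀ k : Fin 4, u + dir k ∉ V → ∃ (K : Fin 4) (c₁ c₂ : ℤ),
      (∀ v : ℤ × ℤ, |v.1 - u.1| ≤ 3 → |v.2 - u.2| ≤ 3 →
        (v ∈ V ↔ c₂ ≤ v.1 * (dir (K + 1)).1 + v.2 * (dir (K + 1)).2)) ∨
      (∀ v : ℤ × ℤ, |v.1 - u.1| ≤ 3 → |v.2 - u.2| ≤ 3 →
        (v ∈ V ↔ c₁ ≤ v.1 * (dir K).1 + v.2 * (dir K).2 ∧
          c₂ ≤ v.1 * (dir (K + 1)).1 + v.2 * (dir (K + 1)).2)) ∨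
      (∀ v : ℤ × ℤ, |v.1 - u.1| ≤ 3 → |v.2 - u.2| ≤ 3 →
        (v ∈ V ↔ c₂ ≤ v.1 * (dir (K + 1)).1 + v.2 * (dir (K + 1)).2 ∨
          v.1 * (dir K).1 + v.2 * (dir K).2 ≤ c₁)))
    (hg : c + dir K ∈ (ι.model V).ghosts) : (st t).wired = true ∨ (st (t + 1)).wired = true := by
  obtain ⟨t', ht', hm⟩ := tc_ghost_mention ι V hadm h hst hflat hchart hg
  have htouch := touch_of_mention V hm
  have hext := se_cycle_exterior ι V hadm h ht'
  rcases se_rail_ghostCorner hch hext.1 hext.2 htouch with hd | hd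
  · obtain rfl := se_cycle_index_inj ι V hadm h ht' ht (hd.trans hds.symm)
    exact wired_of_mention V ht hm
  · obtain ⟨tp, htp, hdsp, -, hwp, -⟩ := se_pred_index ι V hadm h hst ht hpred1 hpred0
    obtain rfl := se_cycle_index_inj ι V hadm h ht' htp (hd.trans hdsp.symm)
    left
    rw [← hwp]
    have hx : ((cycle V d₀)[t']).1 ≠ c + dir K ∧ dartTip (cycle V d₀)[t'] ≠ c + dir K := by
      rw [hd]
      obtain ⟨e0, -, -, -⟩ := se_dir_frame K c
      constructor
      · show c - dir (K + 1) ≠ c + dir K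
        have e : c - dir (K + 1) = c + (-1 : ℤ) • dir (K + 1) + (0 : ℤ) • dir K := by module
        rw [e, e0, Ne, se_frame_inj]; omega
      · show c - dir (K + 1) + dir K ≠ c + dir K
        have e : c - dir (K + 1) + dir K = c + (-1 : ℤ) • dir (K + 1) + (1 : ℤ) • dir K := by module
        rw [e, e0, Ne, se_frame_inj]; omega
    rw [Ne, mention_eq_none_iff] at hm
    by_contra hw
    apply hm
    refine ⟨fun hA => ?_, fun hB => hw hB.1⟩
    rcases hA.2 with h1 | h1
    · exact hx.1 h1
    · exact hx.2 h1

include hadm h hst ht hch hchp hds hpred1 hpred0 in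
/-- **Tracked corners with closed target at the ghost of a rail dart are registered ends.** At a
rail dart `ds[t] = (c, K)` with ghost `g = c + dir K`: a tracked corner `(g, k)` whose target edge
is closed in the completed configuration of `∅` is a strand end of `strandEnds` — necessarily
`k = K + 2`, the stretch before `ds[t]` is free and the stretch after it wired (a junction opening
the arc), the end being `((g, K + 2), min ℓ ℓ')`. [folklore] -/
theorem tc_railGhost_end
    (hflat : ∀ x ∈ insert ι.sink ι.source, ∃ dvec : ℤ × ℤ,
      (dvec = (1, 0) ∨ dvec = (-1, 0) ∨ dvec = (0, 1) ∨ dvec = (0, -1)) ∧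
      ∀ v : ℤ × ℤ, (v.1 - x.1) ^ 2 + (v.2 - x.2) ^ 2 ≤ ((ι.sinkLegs : ℤ) + 3) ^ 2 →
        (v ∈ V ↔ 0 ≤ (v.1 - x.1) * dvec.1 + (v.2 - x.2) * dvec.2))
    (hchart : ∀ u ∈ V, ∀ k : Fin 4, u + dir k ∉ V → ∃ (K : Fin 4) (c₁ c₂ : ℤ),
      (∀ v : ℤ × ℤ, |v.1 - u.1| ≤ 3 → |v.2 - u.2| ≤ 3 →
        (v ∈ V ↔ c₂ ≤ v.1 * (dir (K + 1)).1 + v.2 * (dir (K + 1)).2)) ∨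
      (∀ v : ℤ × ℤ, |v.1 - u.1| ≤ 3 → |v.2 - u.2| ≤ 3 →
        (v ∈ V ↔ c₁ ≤ v.1 * (dir K).1 + v.2 * (dir K).2 ∧
          c₂ ≤ v.1 * (dir (K + 1)).1 + v.2 * (dir (K + 1)).2)) ∨
      (∀ v : ℤ × ℤ, |v.1 - u.1| ≤ 3 → |v.2 - u.2| ≤ 3 →
        (v ∈ V ↔ c₂ ≤ v.1 * (dir (K + 1)).1 + v.2 * (dir (K + 1)).2 ∨
          v.1 * (dir K).1 + v.2 * (dir K).2 ≤ c₁)))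
    {k : Fin 4} (htr : (ι.model V).IsTracked (toSite (c + dir K), k))
    (hcl : cTgt (toSite (c + dir K), k) ∉ (ι.model V).cfgOf ∅) :
    ∃ m : ℤ, ((toSite (c + dir K), k), m) ∈ ι.strandEnds V := by
  obtain ⟨hcV, hcK, -⟩ := se_rail_local hch
  have hgVC : c + dir K ∈ (ι.model V).vertexCells := by simpa using htr.1
  have hg : c + dir K ∈ (ι.model V).ghosts := (Finset.mem_union.1 hgVC).resolve_left hcK
  have hw := tc_railGhost_wired ι V hadm h hst ht hch hds hpred1 hpred0 hflat hchart hg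
  obtain ⟨out0, out3⟩ := se_ghost_outer_faces ι V hch
  rcases se_fin4_cases K k with rfl | rfl | rfl | rfl
  · exact absurd htr.2 out0
  · -- `k = K + 1`: the target is the spoke `{g, c}`, open
    exfalso
    apply hcl
    obtain ⟨harcV, -⟩ := se_arc_and_ghost ι V h hst ht hch hds hw
    obtain ⟨e, hc, hend⟩ := se_corner_edge (c + dir K) (K + 1)
    have hKK : c + dir K + dir (K + 1 + 1) = c := by rw [(tp_fin4 K).1, tp_dir_add_two]; abel
    rw [hKK] at hend
    rw [se_cTgt_mem_cfgOf_iff _ _ hc]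
    exact Or.inr (tc_spoke_open _ harcV hcK hend.symm).2
  · -- `k = K + 2`: the target is the far edge of the face before the dart
    cases hw0 : (st t).wired
    · -- free before, hence wired after: the junction opening the arc at `ds[t]`
      have hw1 : (st (t + 1)).wired = true := by
        rcases hw with hw | hw
        · rw [hw0] at hw; exact absurd hw (by decide)
        · exact hw
      have hact : (st (t + 1)).level ≠ (st t).level :=
        tc_level_ne_of_wired_ne ι V hst ht (by rw [hw0, hw1]; decide)
      obtain ⟨-, hjw, -⟩ := se_active_delta ι V hst ht hact
      have hnj : ¬ ((st (t + 1)).level = (st t).level + 2 ∨ (st t).level = (st (t + 1)).level + 2) :=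
        fun hj => by have := (hjw hj).2; rw [hw1] at this; exact absurd this (by decide)
      have hends := se_endsAt_junction (c, K) (st t) (st (t + 1)) hact hnj
      rw [hw0] at hends
      simp only [Bool.false_eq_true, if_false] at hends
      refine ⟨min (st t).level (st (t + 1)).level, (se_mem_strandEnds_iff ι V h hst).2 ⟨t, ht, ?_⟩⟩
      rw [hds, hends]
      simp [dartTip]
    · -- wired before: the face before is a pocket and the target is a pocket edge, open
      exfalso
      apply hcl
      obtain ⟨hcpV, hcpK, -⟩ := se_rail_local hchp
      obtain ⟨tp, htp, hdsp, -, hwp, -⟩ := se_pred_index ι V hadm h hst ht hpred1 hpred0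
      have hpC : gapFace (c - dir (K + 1), K) ∈ (ι.collar V).pocket :=
        (mem_collar_pocket_iff ι V h hst).2 ⟨tp, htp, by rw [hwp, hw0], by rw [hdsp]⟩
      have hpB : gapFace (c - dir (K + 1), K) ∈ SixVertex.bdryFaces V :=
        tc_gapFace_mem_bdryFaces (d := (c - dir (K + 1), K)) hcpV hcpK
      have hp : gapFace (c - dir (K + 1), K) ∈ (ι.model V).pockets := Finset.mem_inter.2 ⟨hpC, hpB⟩
      obtain ⟨e, hc, hend⟩ := se_corner_edge (c + dir K) (K + 2)
      have hface : gapFace (c + dir K, K + 2) = gapFace (c - dir (K + 1), K) :=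
        (se_gapFace_eq_cFace (c + dir K) (K + 2)).1.trans (se_gapFace_eq_cFace c K).2.2.2.symm
      have he : e ∈ faceEdges (gapFace (c - dir (K + 1), K)) :=
        hface ▸ tc_target_mem_faceEdges (c + dir K) (K + 2) hend
      rw [(tp_fin4 K).2.1] at hend
      have hg' : c + dir K + dir (K + 3) ∉ V := by
        have e1 : c + dir K + dir (K + 3) = c + (-1 : ℤ) • dir (K + 1) + (1 : ℤ) • dir K := by
          rw [tp_dir_add_three]; module
        rw [e1]; intro hm
        have := (hch (-1) 1 (by norm_num) (by norm_num) (by norm_num) (by norm_num)).1 hm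
        omega
      rw [se_cTgt_mem_cfgOf_iff _ _ hc]
      refine Or.inr (tc_pocketEdge_open _ hp he ?_ ?_ ?_)
      · rcases hend with ⟨h1, -⟩ | ⟨h1, -⟩ <;> rw [h1]
        exacts [hcK, hg']
      · rcases hend with ⟨-, h2⟩ | ⟨-, h2⟩ <;> rw [h2]
        exacts [hg', hcK]
      · rcases hend with ⟨h1, -⟩ | ⟨-, h2⟩
        · exact Or.inl (h1 ▸ hgVC)
        · exact Or.inr (h2 ▸ hgVC)
  · exact absurd htr.2 out3

end Rail

/-! ### Registered one-line form -/

/-- **Sub-goal `s14_trackedCuts_railGhost`** (registered on stmt-CriticalPhenomena-14132): for an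
admissible leg insertion with FLAT insertion points on a `V` with local CHARTS, at a rail dart
`ds[t] = (c, K)` of the collar walk (radius-`2` frame charts at `c` and at `c - dir (K+1)`, previous
dart `(c - dir (K+1), K)`), every TRACKED corner at the ghost `c + dir K` whose target edge is
closed in the completed configuration of no live edge is a registered strand end (the end of the
junction opening the arc at `ds[t]`). [folklore] -/
theorem s14_trackedCuts_railGhost : ∀ (ι : Literature.Probability.LatticeModels.CollarLegModel.LegInsertionData) (V : Finset (ℤ × ℤ)) (d₀ : Literature.Probability.LatticeModels.CollarLegModel.Dart) (st : ℕ → Literature.Probability.LatticeModels.CollarLegModel.WalkState), ι.IsAdmissible V → Literature.Probability.LatticeModels.CollarLegModel.outDart V ι.sink = some d₀ → (∀ t, st t = List.foldl (fun s d => s.step (ι.startAt V d)) ι.init ((Literature.Probability.LatticeModels.CollarLegModel.cycle V d₀).take t)) → (∀ x ∈ insert ι.sink ι.source, ∃ dvec : ℤ × ℤ, (dvec = (1, 0) ∨ dvec = (-1, 0) ∨ dvec = (0, 1) ∨ dvec = (0, -1)) ∧ ∀ v : ℤ × ℤ, (v.1 - x.1) ^ 2 + (v.2 - x.2) ^ 2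 ≤ ((ι.sinkLegs : ℤ) + 3) ^ 2 → (v ∈ V ↔ 0 ≤ (v.1 - x.1) * dvec.1 + (v.2 - x.2) * dvec.2)) → (∀ u ∈ V, ∀ k : Fin 4, u + Literature.Probability.LatticeModels.CollarLegModel.dir k ∉ V → ∃ (K : Fin 4) (c₁ c₂ : ℤ), (∀ v : ℤ × ℤ, |v.1 - u.1| ≤ 3 → |v.2 - u.2| ≤ 3 → (v ∈ V ↔ c₂ ≤ v.1 * (Literature.Probability.LatticeModels.CollarLegModel.dir (K + 1)).1 + v.2 * (Literature.Probability.LatticeModels.CollarLegModel.dir (K + 1)).2)) ∨ (∀ v : ℤ × ℤ, |v.1 - u.1| ≤ 3 → |v.2 - u.2| ≤ 3 → (v ∈ V ↔ c₁ ≤ v.1 * (Literature.Probability.LatticeModels.CollarLegModel.dir K).1 + v.2 * (Literature.Probability.LatticeModels.CollarLegModel.dir K).2 ∧ c₂ ≤ v.1 * (Literature.Probability.LatticeModels.CollarLegModel.dir (K + 1)).1 + v.2 * (Literature.Probability.LatticeModels.CollarLegModel.dir (K + 1)).2)) ∨ (∀ v : ℤ × ℤ, |v.1 - u.1| ≤ 3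 → |v.2 - u.2| ≤ 3 → (v ∈ V ↔ c₂ ≤ v.1 * (Literature.Probability.LatticeModels.CollarLegModel.dir (K + 1)).1 + v.2 * (Literature.Probability.LatticeModels.CollarLegModel.dir (K + 1)).2 ∨ v.1 * (Literature.Probability.LatticeModels.CollarLegModel.dir K).1 + v.2 * (Literature.Probability.LatticeModels.CollarLegModel.dir K).2 ≤ c₁))) → ∀ (t : ℕ) (ht : t < (Literature.Probability.LatticeModels.CollarLegModel.cycle V d₀).length) (c : ℤ × ℤ) (K : Fin 4), (∀ s t : ℤ, -2 ≤ s → s ≤ 2 → -2 ≤ t → t ≤ 2 → (c + s • Literature.Probability.LatticeModels.CollarLegModel.dir (K + 1) + t • Literature.Probability.LatticeModels.CollarLegModel.dir K ∈ V ↔ t ≤ 0)) → (∀ s t : ℤ, -2 ≤ s → s ≤ 2 → -2 ≤ t → t ≤ 2 → (c - Literature.Probability.LatticeModels.CollarLegModel.dir (K + 1) + s • Literature.Probability.LatticeModels.CollarLegModel.dir (K + 1) + t • Literature.Probability.LatticeModels.CollarLegModel.dir K ∈ V ↔ t ≤ 0)) → (Literature.Probability.LatticeModels.CollarLegModel.cycle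 V d₀)[t] = (c, K) → (∀ (h1 : 1 ≤ t), (Literature.Probability.LatticeModels.CollarLegModel.cycle V d₀)[t - 1] = (c - Literature.Probability.LatticeModels.CollarLegModel.dir (K + 1), K)) → (t = 0 → (Literature.Probability.LatticeModels.CollarLegModel.cycle V d₀)[(Literature.Probability.LatticeModels.CollarLegModel.cycle V d₀).length - 1] = (c - Literature.Probability.LatticeModels.CollarLegModel.dir (K + 1), K)) → ∀ k : Fin 4, (ι.model V).IsTracked (Literature.Probability.LatticeModels.CollarLegModel.toSite (c + Literature.Probability.LatticeModels.CollarLegModel.dir K), k) → Literature.Probability.LatticeModels.cTgt (Literature.Probability.LatticeModels.CollarLegModel.toSite (c + Literature.Probability.LatticeModels.CollarLegModel.dir K), k) ∉ (ι.model V).cfgOf ∅ → ∃ m : ℤ, ((Literature.Probability.LatticeModels.CollarLegModel.toSite (c + Literature.Probability.LatticeModels.CollarLegModel.dir K), k), m) ∈ ι.strandEnds V :=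
  fun ι V _ _ hadm h hst hflat hchart _ ht _ _ hch hchp hds hpred1 hpred0 _ htr hcl =>
    tc_railGhost_end ι V hadm h hst ht hch hchp hds hpred1 hpred0 hflat hchart htr hcl

end Summit.CriticalPhenomena.CardyFormulaZ2.Cruxes.BoundaryDefectGaussianR.RainbowMonomialsInExcursionKernels
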